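/-
Copyright (c) 2026 the pub-hodgecm-mathlib formalisation cell (harness21).  Prover seat hodgecm-mathlib-K2E1-p10 (g0), Track B ∕ K2-LIT, h413 = `stmt-HodgeConjecture-24833`,
line `K2_E1_TraceFormulaBeta`, campaign «EIS-R7-BL-SPH-3», deal (44)∕(46) «CLOSER₃» FILE (b) of the dealer K2E1-plan (g6) (2026-09-04T10:11:49Z «GO (a) → (b) → (c) as NEW files citing ★»;
head bytes REPORT-FIRST 10:2xZ): the `(σ₀, ρ₀)`-edition of ★ P8 §2 `K2E1SphericalEisensteinMeromorphicBallU2.sphericalEisenstein_meromorphicOn_ball_of_letters` (K2E3-p12, p859005; INFO #22).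
-/
import Summits.HodgeConjecture.HodgeConjecture.Theorems.K2E1SphericalEisensteinMeromorphicBallU2   -- ★ P8 §2 (K2E3-p12): ED. 1 at (1,1) and its §1 bricks `exists_meromorphicOn_scalar_of_system'`, `piN_…`, `isCompactOperator_…`
import HarnessLib

/-!
# K2·E1 — `K2E1SphericalEisensteinMeromorphicBallOfLtU`: BERNSTEIN–LAPID ON ONE BALL OVER THE CONCRETE SPACES, LETTERS HYPOTHESIS-FIRST — THE `(σ₀, ρ₀)`-EDITION
# (Godement half-plane `{σ₀ < Re z}`, constant term `φ₀H^z + b·H^{ρ₀−z}`; `(1, 1)` = ★ ED. 1 for `U(1,1)`, `(2, 2)` = `U(2,1)`)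

Track B ∕ K2-LIT, crux h413 = `stmt-HodgeConjecture-24833`, route of record `HCCMUnconditional`; cell `hodgecm-mathlib`, squad K2, ENGINE E1 (campaign «EIS-R7-BL-SPH-3», closer₃).
THEOREMS ONLY (no `def`, no `instance`, no notation, no named-fact hypothesis, no `sorry`; default heartbeats); lane `--supports stmt-HodgeConjecture-24833 --as helper` (count-neutral).
★ P8 §2 `sphericalEisenstein_meromorphicOn_ball_of_letters` (p859005) is rank-generic in `(F, E, c, N)` but hard-wires the `U(1,1)` numerology: the Godement half-plane `{1 < Re z}` in the
letters `hsolT hsolC hsolQ hunq hΛ` and the conclusion, the second constant-term exponent `H^{1−z}` in `hα₂`, and the weight bound `k ≥ n + 3`.  For `U(2,1)` the Eisenstein series converges on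
`{2 < Re z}` and its constant term is `φ₀H^z + c(z)H^{2−z}` (★ `…InWeightedSpaceU3` :65), so the N = 3 instantiation of ED. 1 would be vacuous (boxer INFO #22).  This file is ED. 1's statement
and proof VERBATIM with `1 < z.re ↦ σ₀ < z.re`, `1 − z ↦ ρ₀ − z`, `n + 3 ≤ k ↦ n + 2 + ρ₀ ≤ k` (`ρ₀ ≥ 0`; the strip `|Re z| < n + 2` of the ball puts `Re(ρ₀ − z)` in `(ρ₀ − n − 2, ρ₀ + n + 2)`,
whence ★ `differentiableOn_HN_of_ae_eq_cpow (φ := fun z => ρ₀ − z)`); ball radius `n + 2` unchanged (the convention of ★ BallData₃ p859164, k = n + 4 = n + 2 + ρ₀ at ρ₀ = 2).  All bricks are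
★ §2's §1 (`exists_meromorphicOn_scalar_of_system'` with `O := {σ₀ < re}`, `piN_comp_restrHN_comp_iota`, `isCompactOperator_deltaShift_comp_one_sub_cnstN`) and ★ G-c `exists_xSystem` — CITED.
* ONE HEAD **`sphericalEisenstein_meromorphicOn_ball_of_letters_of_lt (σ₀ ρ₀ : ℝ) (hρ₀ : 0 ≤ ρ₀) (n k : ℕ) (hk : n + 2 + ρ₀ ≤ k) …`** — the `hball n g` clause of ★ (a)
  `K2E1BLMeromorphicGluingOfLt.sphericalEisenstein_meromorphic_of_eventually_balls_cm_three` at `(σ₀, ρ₀) = (2, 2)`.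
HONEST LABEL: HC_CM is proved only modulo the 7 printed citations (2 remaining named inputs: hLiu418 = `stmt-HodgeConjecture-24832`, h413 = `stmt-HodgeConjecture-24833`)
until rung 0 closes; this file asserts no named fact, closes no socket and crosses no ceiling by itself; count-neutral.  NOT claimed: location of poles, functional equation.
References: [BernsteinLapid2019] J. Bernstein, E. Lapid, *On the meromorphic continuation of Eisenstein series*, arXiv:1911.02342 (JAMS 37 (2024)), Thm 2.3, §4 Claims 3–5 and p. 10 ·
[MoeglinWaldspurger1995] C. Mœglin, J.-L. Waldspurger, *Spectral Decomposition and Eisenstein Series*, IV.1.8.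
-/

set_option autoImplicit false
-- the mandated namespace repeats `HodgeConjecture.HodgeConjecture`, as in every `Theorems/*.lean` of this sub-problem
set_option linter.dupNamespace false

noncomputable section

open MeasureTheory Filter Topology Set Submodule NumberField
open scoped NNReal ENNReal Classical
open Literature.NumberTheory.Automorphic Literature.NumberTheory.Automorphic.UnitaryGroup AdelicGroupData
open Summit.HodgeConjecture.HodgeConjecture.Cruxes.H413.K2E1BorelEisensteinU
open Summit.HodgeConjecture.HodgeConjecture.Cruxes.H413.K2E1BLBorelSpacesU2Defs
open Summit.HodgeConjecture.HodgeConjecture.Cruxes.H413.K2E1BLBorelOperatorsU2Defs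
open Summit.HodgeConjecture.HodgeConjecture.Cruxes.H413.K2E1SphericalHeckeEigenSectionU2 (differentiable_integral_mul_borelHeight_cpow)
open Summit.HodgeConjecture.HodgeConjecture.Cruxes.H413.K2E1BLXSystemPackage (exists_xSystem xSystem_existsUnique_of)
open Summit.HodgeConjecture.HodgeConjecture.Cruxes.H413.K2E1BLHeightPowerHolomorphicU2 (differentiableOn_HN_of_ae_eq_cpow differentiableOn_HN_of_ae_eq_cpow_self)
open Summit.HodgeConjecture.HodgeConjecture.Cruxes.H413.K2E1SphericalEisensteinMeromorphicBallU2 (exists_meromorphicOn_scalar_of_system' piN_comp_restrHN_comp_iota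
  isCompactOperator_deltaShift_comp_one_sub_cnstN)

namespace Summit.HodgeConjecture.HodgeConjecture.Cruxes.H413.K2E1SphericalEisensteinMeromorphicBallOfLtU

variable {F E : Type} [Field F] [NumberField F] [Field E] [NumberField E] [Algebra F E] {c : E ≃ₐ[F] E} {N : ℕ} [NeZero N]
variable [MeasurableSpace (quasiSplit F E c N).Adelic] [BorelSpace (quasiSplit F E c N).Adelic]

/-- **BERNSTEIN–LAPID ON ONE BALL, LETTERS HYPOTHESIS-FIRST — THE `(σ₀, ρ₀)`-EDITION** (Godement half-plane `{σ₀ < Re z}`, second exponent `H^{ρ₀−z}`, weight `k ≥ n + 2 + ρ₀`; ★ ED. 1 = `(1, 1)`; `U(2,1)` = `(2, 2)`). [BernsteinLapid2019, §4 Claims 3–5 and p. 10, with Thm 2.3 and §2.1].  Data: weight `k ≥ n + 2 + ρ₀`; levels `0 < a ≤ a₀ i`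
(`i ∈ I` finite, `i₀ ∈ I`); the ι-package `hb hb₀ hcl₀ hinj₀`; `μZ(Z_a) < ∞` and finite weighted measures at the levels `a₀ i`; test functions `h i` (continuous, compact support) with
transforms `ĥ_i(z) = ∫ h_i·H^z dνG` having no common zero on the ball and `ĥ_{i₀} ≢ 0`; `ShiftBound` letters `hs i`; K2's decay letters `hK1 i`; the `𝔛`-side operators `T i` with the
intertwining `hδι i : δ_i ∘ ι = restr ∘ ι ∘ T_i`; `α₁ =ᵐ H^z`, `α₂ =ᵐ H^{ρ₀−z}` (`α₂ ≠ 0`); a cusp-orthogonality operator `Q`; the Eisenstein data `eX z ∈ 𝓗_k(𝔛)`, `bX z` solving the three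
conditions on the Godement set; uniqueness of the `ψ`-component on some open non-empty `U₀` inside `ball ∩ {σ₀ < re}`; and a functional `Λ` with `Λ(eX z) = ĥ_{i₀}(z)·E(φ₀H^z)(g)`.
THEN `∃ Ec : ℂ → ℂ` meromorphic on `ball 0 (n + 2)` with `Ec z = E(φ₀H^z)(g)` for `z` in the ball with `σ₀ < Re z` — the `hball n g` clause of ★ `sphericalEisenstein_meromorphic_of_balls`.
[cite: BernsteinLapid2019, §4 Claims 3–5 and p. 10] [cite: MoeglinWaldspurger1995, IV.1.8] -/
theorem sphericalEisenstein_meromorphicOn_ball_of_letters_of_lt (σ₀ ρ₀ : ℝ) (hρ₀ : 0 ≤ ρ₀) (n k : ℕ) (hk : (n : ℝ) + 2 + ρ₀ ≤ k) {μ : Measure (quasiSplit F E c N).automorphicQuotient}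
    {μZ : Measure (borelQuotient F E c N)} (νG : Measure (quasiSplit F E c N).Adelic) [IsFiniteMeasureOnCompacts νG]
    -- levels and the ι-package
    {I : Type} [Fintype I] (i₀ : I) {a : ℝ≥0} (ha : 0 < a) {a₀ : I → ℝ≥0} (haa₀ : ∀ i, a ≤ a₀ i) (hfin : μZ {z | a < borelQuotHeight F E c N z} ≠ ∞)
    [hfin₀ : ∀ i, IsFiniteMeasure (weightedTruncMeasure F E c N k (a₀ i) μZ)] (hb : IotaBound F E c N k a μ μZ) (hb₀ : ∀ i, IotaBound F E c N k (a₀ i) μ μZ)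
    (hcl₀ : ∀ i, IsClosed ((LinearMap.range (iota (hb₀ i)).toLinearMap : Submodule ℂ (HN F E c N k (a₀ i) μZ)) : Set (HN F E c N k (a₀ i) μZ)))
    (hinj₀ : ∀ i, Function.Injective (iota (hb₀ i)))
    -- the good test functions and their transforms
    (h : I → (quasiSplit F E c N).Adelic → ℂ) (hhc : ∀ i, Continuous (h i)) (hhs : ∀ i, HasCompactSupport (h i))
    (hcov : ∀ z ∈ Metric.ball (0 : ℂ) (n + 2), ∃ i, (∫ x, h i x * (((borelHeight x : ℝ≥0) : ℝ) : ℂ) ^ z ∂νG) ≠ 0)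
    (hĥ₀ : ∃ z ∈ Metric.ball (0 : ℂ) (n + 2), (∫ x, h i₀ x * (((borelHeight x : ℝ≥0) : ℝ) : ℂ) ^ z ∂νG) ≠ 0)
    -- the `Z`-side Hecke operators (★ `ShiftBound`) and K2's decay letters
    (hs : ∀ i, ShiftBound F E c N k a (a₀ i) νG μZ (h i)) {m C : I → ℝ} (hm : ∀ i, 0 ≤ m i) (hC : ∀ i, 0 ≤ C i)
    (hK1 : ∀ i, ∀ f : HNcusp F E c N k a μZ, ∀ᵐ z ∂(weightedTruncMeasure F E c N k (a₀ i) μZ),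
      ‖rightConvFun F E c N νG (h i) ((f : HN F E c N k a μZ) : borelQuotient F E c N → ℂ) z‖ ≤ C i * ‖f‖ * ((borelQuotHeight F E c N z : ℝ)) ^ (-m i))
    -- the `𝔛`-side Hecke operators and the intertwining (P3-C)
    (T : I → HX F E c N k μ →L[ℂ] HX F E c N k μ) (hδι : ∀ i, deltaShift (hs i) ∘L iota hb = restrHN F E c N k (haa₀ i) μZ ∘L iota hb ∘L T i)
    -- the constant-term vectors (`=ᵐ` letters, `toHN` of `H^z`, `H^{1−z}`) and the cusp-orthogonality operator
    {α₁ α₂ : ℂ → HN F E c N k a μZ}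
    (hα₁ : ∀ z ∈ Metric.ball (0 : ℂ) (n + 2), (α₁ z : borelQuotient F E c N → ℂ) =ᵐ[weightedTruncMeasure F E c N k a μZ] fun x => (((borelQuotHeight F E c N x : ℝ≥0) : ℝ) : ℂ) ^ z)
    (hα₂ : ∀ z ∈ Metric.ball (0 : ℂ) (n + 2), (α₂ z : borelQuotient F E c N → ℂ) =ᵐ[weightedTruncMeasure F E c N k a μZ] fun x => (((borelQuotHeight F E c N x : ℝ≥0) : ℝ) : ℂ) ^ ((ρ₀ : ℂ) - z))
    (hα₂ne : ∀ z ∈ Metric.ball (0 : ℂ) (n + 2), α₂ z ≠ 0) {X' : Type} [NormedAddCommGroup X'] [NormedSpace ℂ X'] [CompleteSpace X'] (Q : HX F E c N k μ →L[ℂ] X') (φ₀ : ℂ)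
    -- the Eisenstein data in `𝓗_k(𝔛)` on the Godement set ((b1) + ℓ9 + P2b-A∕P7 + P7-B)
    (eX : ℂ → HX F E c N k μ) (bX : ℂ → ℂ)
    (hsolT : ∀ z ∈ Metric.ball (0 : ℂ) (n + 2), σ₀ < z.re → ∀ i, T i (eX z) = (∫ x, h i x * (((borelHeight x : ℝ≥0) : ℝ) : ℂ) ^ z ∂νG) • eX z)
    (hsolC : ∀ z ∈ Metric.ball (0 : ℂ) (n + 2), σ₀ < z.re → cnstN F E c N k a μZ (iota hb (eX z)) = φ₀ • α₁ z + bX z • α₂ z)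
    (hsolQ : ∀ z ∈ Metric.ball (0 : ℂ) (n + 2), σ₀ < z.re → Q (eX z) = 0)
    -- uniqueness of the `ψ`-component on an open non-empty part of the Godement set (P6′)
    (hunq : ∃ U₀ : Set ℂ, IsOpen U₀ ∧ U₀.Nonempty ∧ U₀ ⊆ Metric.ball (0 : ℂ) (n + 2) ∩ {z : ℂ | σ₀ < z.re} ∧
      ∀ z ∈ U₀, ∀ (ψ : HX F E c N k μ) (b : ℂ), (∀ i, T i ψ = (∫ x, h i x * (((borelHeight x : ℝ≥0) : ℝ) : ℂ) ^ z ∂νG) • ψ) →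
        cnstN F E c N k a μZ (iota hb ψ) = φ₀ • α₁ z + b • α₂ z → Q ψ = 0 → ψ = eX z)
    -- the evaluation functional after `δ(h_{i₀})` at `g` (P3-D)
    (g : (quasiSplit F E c N).Adelic) (Λ : HX F E c N k μ →L[ℂ] ℂ)
    (hΛ : ∀ z ∈ Metric.ball (0 : ℂ) (n + 2), σ₀ < z.re →
      Λ (eX z) = (∫ x, h i₀ x * (((borelHeight x : ℝ≥0) : ℝ) : ℂ) ^ z ∂νG) * eisensteinSeriesU (flatSectionU (fun _ : (quasiSplit F E c N).Adelic => φ₀) z) g) :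
    ∃ Ec : ℂ → ℂ, MeromorphicOn Ec (Metric.ball (0 : ℂ) (n + 2)) ∧
      ∀ z ∈ Metric.ball (0 : ℂ) (n + 2), σ₀ < z.re → Ec z = eisensteinSeriesU (flatSectionU (fun _ : (quasiSplit F E c N).Adelic => φ₀) z) g := by
  -- the ball and the strip bounds for `α₁`, `α₂`
  have hD : IsOpen (Metric.ball (0 : ℂ) (n + 2)) := Metric.isOpen_ball
  have hDc : IsPreconnected (Metric.ball (0 : ℂ) (n + 2)) := (convex_ball (0 : ℂ) _).isPreconnected
  have hre : ∀ z ∈ Metric.ball (0 : ℂ) (n + 2), |z.re| < n + 2 := fun z hz =>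
    lt_of_le_of_lt (Complex.abs_re_le_norm z) (by rwa [Metric.mem_ball, dist_zero_right] at hz)
  -- holomorphy of the transforms and of `α₁`, `α₂`
  have hĥ : ∀ i, DifferentiableOn ℂ (fun z : ℂ => ∫ x, h i x * (((borelHeight x : ℝ≥0) : ℝ) : ℂ) ^ z ∂νG) (Metric.ball (0 : ℂ) (n + 2)) := fun i =>
    (differentiable_integral_mul_borelHeight_cpow νG (hhc i) (hhs i)).differentiableOn
  have hα₁d : DifferentiableOn ℂ α₁ (Metric.ball (0 : ℂ) (n + 2)) :=
    differentiableOn_HN_of_ae_eq_cpow_self (σ₀ := -((n : ℝ) + 2)) (σ₁ := (n : ℝ) + 2) ha hfin (by linarith) (by linarith) hD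
      (fun z hz => ⟨by linarith [(abs_lt.1 (hre z hz)).1], by linarith [(abs_lt.1 (hre z hz)).2]⟩) hα₁
  have hα₂d : DifferentiableOn ℂ α₂ (Metric.ball (0 : ℂ) (n + 2)) :=
    differentiableOn_HN_of_ae_eq_cpow (φ := fun z : ℂ => (ρ₀ : ℂ) - z) (σ₀ := ρ₀ - ((n : ℝ) + 2)) (σ₁ := ρ₀ + ((n : ℝ) + 2)) ha hfin (by linarith) (by linarith) hD
      ((differentiableOn_const _).sub differentiableOn_id)
      (fun z hz => by
        simp only [Complex.sub_re, Complex.ofReal_re]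
        exact ⟨by linarith [(abs_lt.1 (hre z hz)).2], by linarith [(abs_lt.1 (hre z hz)).1]⟩) hα₂
  -- the packaged `𝔛`-system (★ G-c) over the concrete letters
  haveI : CompleteSpace ((I → HX F E c N k μ) × (HN F E c N k a μZ × X')) := inferInstance
  obtain ⟨A, cc, hA, hcc, hchar, hfinT⟩ := exists_xSystem (V₀ := fun i => HN F E c N k (a₀ i) μZ) hD T hĥ hcov (iota hb) (cnstN F E c N k a μZ) Q hα₁d hα₂d φ₀
    (fun i => deltaShift (hs i)) (fun i => restrHN F E c N k (haa₀ i) μZ) (fun i => piN (hb₀ i) (hcl₀ i) (hinj₀ i)) hδι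
    (fun i => piN_comp_restrHN_comp_iota (haa₀ i) hb (hb₀ i) (hcl₀ i) (hinj₀ i))
    (fun i => isCompactOperator_deltaShift_comp_one_sub_cnstN (lt_of_lt_of_le ha (haa₀ i)) (hs i) (hm i) (hC i) (hK1 i))
  -- existence on the Godement set, uniqueness on `U₀`, the functional identity; assemble
  have hsol : ∀ z ∈ Metric.ball (0 : ℂ) (n + 2) ∩ {z : ℂ | σ₀ < z.re}, A z (eX z, bX z) = cc z := fun z hz =>
    (hchar z (eX z) (bX z)).2 ⟨hsolT z hz.1 hz.2, hsolC z hz.1 hz.2, hsolQ z hz.1 hz.2⟩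
  obtain ⟨U₀, hU₀o, hU₀ne, hU₀D, hU₀unq⟩ := hunq
  have hunq' : ∃ U₀ : Set ℂ, IsOpen U₀ ∧ U₀.Nonempty ∧ U₀ ⊆ Metric.ball (0 : ℂ) (n + 2) ∩ {z : ℂ | σ₀ < z.re} ∧ ∀ z ∈ U₀, ∀ w : HX F E c N k μ × ℂ, A z w = cc z → w = (eX z, bX z) := by
    refine ⟨U₀, hU₀o, hU₀ne, hU₀D, fun z hz w hw => ?_⟩
    have hex : ∃! x : HX F E c N k μ × ℂ, A z x = cc z :=
      xSystem_existsUnique_of hchar (hα₂ne z (hU₀D hz).1) (hsol z (hU₀D hz)) fun ψ b hψb =>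
        hU₀unq z hz ψ b ((hchar z ψ b).1 hψb).1 ((hchar z ψ b).1 hψb).2.1 ((hchar z ψ b).1 hψb).2.2
    exact hex.unique hw (hsol z (hU₀D hz))
  have hΛ' : ∀ z ∈ Metric.ball (0 : ℂ) (n + 2) ∩ {z : ℂ | σ₀ < z.re}, (Λ ∘L ContinuousLinearMap.fst ℂ (HX F E c N k μ) ℂ) (eX z, bX z) =
      (∫ x, h i₀ x * (((borelHeight x : ℝ≥0) : ℝ) : ℂ) ^ z ∂νG) * eisensteinSeriesU (flatSectionU (fun _ : (quasiSplit F E c N).Adelic => φ₀) z) g := fun z hz => by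
    show Λ (eX z) = _
    exact hΛ z hz.1 hz.2
  obtain ⟨Ec, hEc, hEcE⟩ := exists_meromorphicOn_scalar_of_system' (O := {z : ℂ | σ₀ < z.re})
    (E := fun z => eisensteinSeriesU (flatSectionU (fun _ : (quasiSplit F E c N).Adelic => φ₀) z) g) hD hDc hA hcc hfinT (hĥ i₀) hĥ₀ hsol hunq'
    (Λ ∘L ContinuousLinearMap.fst ℂ (HX F E c N k μ) ℂ) hΛ'
  exact ⟨Ec, hEc, fun z _ hz1 => hEcE z hz1⟩

end Summit.HodgeConjecture.HodgeConjecture.Cruxes.H413.K2E1SphericalEisensteinMeromorphicBallOfLtU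

end
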